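import Summits.AtomisticToContinuum.Crystallization.Theorems.FrustratedLawDichotomyCellTEQ15Data

/-!
# FrustratedLawDichotomy · crux `AperiodicFrustratedLawGap` (stmt-AtomisticToContinuum-27623) — TEQ15 witness cell: bin and cover checks
# (decomp-a2c, prover hand 2, generation 17; each theorem ONE `decide +kernel`, split for the farm's per-declaration budget). [folklore]
-/

namespace Summit.AtomisticToContinuum.Crystallization.Theorems.FrustratedLawDichotomyCellTEQ15

open scoped BigOperators
open Summit.AtomisticToContinuum.Crystallization.Theorems.FrustratedLawDichotomyCellChecker
open Summit.AtomisticToContinuum.Crystallization.Theorems.FrustratedLawDichotomyCellKitX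

set_option maxHeartbeats 0 in
/-- The 121 bins of class `0` pass `checkBins` (enclosures + binned chain condition, 8 pieces). [folklore] -/
theorem teq15_checkBins0 : checkBins cellTEQ15 cellTEQ15P cellTEQ15X0 = true := by decide +kernel

set_option maxHeartbeats 0 in
/-- The bins of class `1` pass `checkBins`. [folklore] -/
theorem teq15_checkBins1 : checkBins cellTEQ15 cellTEQ15P cellTEQ15X1 = true := by decide +kernel

set_option maxHeartbeats 0 in
/-- Every in-range bond of class `0` lies in a bin. [folklore] -/
theorem teq15_checkCover0 : checkCover cellTEQ15 cellTEQ15P cellTEQ15X0 ⟨0, by decide⟩ = true := by decide +kernel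

set_option maxHeartbeats 0 in
/-- Every in-range bond of class `1` lies in a bin. [folklore] -/
theorem teq15_checkCover1 : checkCover cellTEQ15 cellTEQ15P cellTEQ15X1 ⟨1, by decide⟩ = true := by decide +kernel

end Summit.AtomisticToContinuum.Crystallization.Theorems.FrustratedLawDichotomyCellTEQ15
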